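import Summits.KontsevichZagierPeriods.KontsevichZagierPeriods.Theorems.SymplecticScissorsRealOnePeriodRelationsStubCellsAux
import Mathlib.Analysis.SpecialFunctions.Sqrt

/-!
# `RealOnePeriodRelations` (stmt-KontsevichZagierPeriods-10042), line `nash-retraction-thin-strip`,
# the quartic-oval layer: the stub `stub_quarticOvalCell`

`QuarticLayer.stub_quarticOvalCell`: a COMPLETE abelian integral of the first kind
`∫_{ε₁}^{ε₂} c₀ dx/√q(x)` over a real oval of the quartic `q(x) = a₄x⁴ + a₃x³ + a₂x² + a₁x + a₀`
(real algebraic coefficients, consecutive real roots `ε₁ < ε₂`, `q > 0` on `(ε₁, ε₂)`,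
`c₃ = q′(ε₁) > 0`) is, modulo `M₁`, the complete branch integral `∫ c₀ dv/√D(v)` over the ray
`(c₃/(ε₂ − ε₁), ∞)` of the MONIC resolvent cubic `D(v) = v³ + c₂v² + c₁c₃v + a₄c₃²`,
`c₂ = q″(ε₁)/2 = 6a₄ε₁² + 3a₃ε₁ + a₂`, `c₁ = q‴(ε₁)/6 = 4a₄ε₁ + a₃`. The real Möbius chart
`φ(x) = c₃/(x − ε₁)` is a decreasing bijection `(ε₁, ε₂) → (c₃/(ε₂ − ε₁), ∞)` with
`φ′(x) = −c₃/(x − ε₁)²`, and the Taylor expansion of `q` at its root `ε₁`,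
`q(ε₁ + h) = c₃h + c₂h² + c₁h³ + a₄h⁴`, is the exact identity
`D(φ(x)) = (c₃/(x − ε₁)²)² · q(x)` (`x ≠ ε₁`), whence `c₀/√q(x) = (c₀/√D(φ x)) · |φ′(x)|` on the
oval, `D(φ(ε₂)) = 0` and `D > 0` on the ray. So the statement is ONE instance of Kontsevich–Zagier's
rule (2) in dimension one, i.e. of the landed packaging `helper_cells_1`: `φ`, `φ′` are
`ℚ`-semialgebraic on the domain because `ε₁` and `c₃` are real algebraic numbers.

References: M. Kontsevich, D. Zagier, *Periods* (2001), §1.2 rule (2); A. Huber, G. Wüstholz,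
*Transcendence and linear relations of `1`-periods* (2022), §13.2.
-/

noncomputable section

open Set MeasureTheory Filter Topology
open Literature.NumberTheory.Transcendental Literature.ModelTheory.ExponentialFields
open Summit.KontsevichZagierPeriods.SymplecticScissors.RealOnePeriodRelationsNegative (M₁ H₁)

namespace Summit.KontsevichZagierPeriods.SymplecticScissors.RealOnePeriodRelations

namespace QuarticLayer

/-- The polynomial identity behind the Möbius move of a quartic oval: if `q(ε) = 0` for
`q(X) = a₄X⁴ + a₃X³ + a₂X² + a₁X + a₀` and `c₃ = q′(ε)`, `c₂ = q″(ε)/2`, `c₁ = q‴(ε)/6`, then for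
`x ≠ ε` the resolvent cubic `D(v) = v³ + c₂v² + c₁c₃v + a₄c₃²` satisfies
`D(c₃/(x − ε)) = (c₃/(x − ε)²)² · q(x)` (Taylor expansion `q(ε + h) = c₃h + c₂h² + c₁h³ + a₄h⁴`).
[folklore] -/
theorem quarticOvalCell_identity {a₄ a₃ a₂ a₁ a₀ ε c₃ c₂ c₁ x : ℝ}
    (hq : a₄ * ε ^ 4 + a₃ * ε ^ 3 + a₂ * ε ^ 2 + a₁ * ε + a₀ = 0)
    (hc₃ : c₃ = 4 * a₄ * ε ^ 3 + 3 * a₃ * ε ^ 2 + 2 * a₂ * ε + a₁)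
    (hc₂ : c₂ = 6 * a₄ * ε ^ 2 + 3 * a₃ * ε + a₂) (hc₁ : c₁ = 4 * a₄ * ε + a₃) (hx : x ≠ ε) :
    (c₃ / (x - ε)) ^ 3 + c₂ * (c₃ / (x - ε)) ^ 2 + c₁ * c₃ * (c₃ / (x - ε)) + a₄ * c₃ ^ 2 =
      (c₃ / (x - ε) ^ 2) ^ 2 * (a₄ * x ^ 4 + a₃ * x ^ 3 + a₂ * x ^ 2 + a₁ * x + a₀) := by
  have ha₀ : a₀ = -(a₄ * ε ^ 4 + a₃ * ε ^ 3 + a₂ * ε ^ 2 + a₁ * ε) := by linarith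
  subst ha₀ hc₃ hc₂ hc₁
  have hxe : x - ε ≠ 0 := sub_ne_zero.mpr hx
  field_simp
  ring

/-- Square roots of `quarticOvalCell_identity` to the right of the root `ε`:
`√D(c₃/(x − ε)) = c₃/(x − ε)² · √q(x)` when `c₃ > 0` and `x > ε`. [folklore] -/
theorem quarticOvalCell_sqrt {a₄ a₃ a₂ a₁ a₀ ε c₃ c₂ c₁ x : ℝ}
    (hq : a₄ * ε ^ 4 + a₃ * ε ^ 3 + a₂ * ε ^ 2 + a₁ * ε + a₀ = 0)
    (hc₃ : c₃ = 4 * a₄ * ε ^ 3 + 3 * a₃ * ε ^ 2 + 2 * a₂ * ε + a₁)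
    (hc₂ : c₂ = 6 * a₄ * ε ^ 2 + 3 * a₃ * ε + a₂) (hc₁ : c₁ = 4 * a₄ * ε + a₃) (hpos : 0 < c₃)
    (hx : ε < x) :
    Real.sqrt ((c₃ / (x - ε)) ^ 3 + c₂ * (c₃ / (x - ε)) ^ 2 + c₁ * c₃ * (c₃ / (x - ε)) +
        a₄ * c₃ ^ 2) =
      c₃ / (x - ε) ^ 2 * Real.sqrt (a₄ * x ^ 4 + a₃ * x ^ 3 + a₂ * x ^ 2 + a₁ * x + a₀) := by
  rw [quarticOvalCell_identity hq hc₃ hc₂ hc₁ hx.ne', Real.sqrt_mul (sq_nonneg _),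
    Real.sqrt_sq (div_pos hpos (pow_pos (sub_pos.2 hx) 2)).le]

/-- The registered statement `stub_quarticOvalCell` with the Taylor coefficients `c₃ = q′(ε₁)`,
`c₂ = q″(ε₁)/2`, `c₁ = q‴(ε₁)/6` kept as atoms: push a representation on `{z | z 0 ∈ (ε₁, ε₂)}`
with integrand `c₀/√q` forward along `x ↦ c₃/(x − ε₁)` by `helper_cells_1` (rule 2); the image is
the ray `{c₃/(ε₂ − ε₁) < z 0}`, the new integrand is `c₀/√D`, `D` vanishes at the end point of the
ray and is positive on it.  (The hypotheses on `a₀`, `ε₂`, `c₀` of the registered interface are not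
needed: `a₀ = −(a₄ε₁⁴ + a₃ε₁³ + a₂ε₁² + a₁ε₁)`, and `ε₂`, `c₀` do not enter the chart.)
[cite: KontsevichZagier2001, §1.2 (rule 2)] -/
theorem quarticOvalCell_of_eq (a₄ a₃ a₂ a₁ a₀ : ℝ) (ha₄ : IsAlgebraic ℚ a₄)
    (ha₃ : IsAlgebraic ℚ a₃) (ha₂ : IsAlgebraic ℚ a₂) (ha₁ : IsAlgebraic ℚ a₁)
    (_ha₀ : IsAlgebraic ℚ a₀) (ε₁ ε₂ c₀ : ℝ) (hε₁ : IsAlgebraic ℚ ε₁) (_hε₂ : IsAlgebraic ℚ ε₂)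
    (_hc₀ : IsAlgebraic ℚ c₀) (c₃ c₂ c₁ : ℝ)
    (hc₃ : c₃ = 4 * a₄ * ε₁ ^ 3 + 3 * a₃ * ε₁ ^ 2 + 2 * a₂ * ε₁ + a₁)
    (hc₂ : c₂ = 6 * a₄ * ε₁ ^ 2 + 3 * a₃ * ε₁ + a₂) (hc₁ : c₁ = 4 * a₄ * ε₁ + a₃) (hlt : ε₁ < ε₂)
    (hq₁ : a₄ * ε₁ ^ 4 + a₃ * ε₁ ^ 3 + a₂ * ε₁ ^ 2 + a₁ * ε₁ + a₀ = 0)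
    (hq₂ : a₄ * ε₂ ^ 4 + a₃ * ε₂ ^ 3 + a₂ * ε₂ ^ 2 + a₁ * ε₂ + a₀ = 0)
    (hpos : ∀ x ∈ Set.Ioo ε₁ ε₂, 0 < a₄ * x ^ 4 + a₃ * x ^ 3 + a₂ * x ^ 2 + a₁ * x + a₀)
    (hder : 0 < c₃) (r : KZ.IntegralRep 1) (hdom : r.domain = {z | z 0 ∈ Set.Ioo ε₁ ε₂})
    (hint : ∀ z ∈ r.domain, r.integrand z =
      c₀ / Real.sqrt (a₄ * (z 0) ^ 4 + a₃ * (z 0) ^ 3 + a₂ * (z 0) ^ 2 + a₁ * (z 0) + a₀)) :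
    ∃ r' : KZ.IntegralRep 1,
      r'.domain = {z | c₃ / (ε₂ - ε₁) < z 0} ∧
      (∀ z ∈ r'.domain, r'.integrand z =
        c₀ / Real.sqrt ((z 0) ^ 3 + c₂ * (z 0) ^ 2 + c₁ * c₃ * (z 0) + a₄ * c₃ ^ 2)) ∧
      (c₃ / (ε₂ - ε₁)) ^ 3 + c₂ * (c₃ / (ε₂ - ε₁)) ^ 2 + c₁ * c₃ * (c₃ / (ε₂ - ε₁)) +
          a₄ * c₃ ^ 2 = 0 ∧
      (∀ v : ℝ, c₃ / (ε₂ - ε₁) < v → 0 < v ^ 3 + c₂ * v ^ 2 + c₁ * c₃ * v + a₄ * c₃ ^ 2) ∧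
      KZ.of r - KZ.of r' ∈ M₁ := by
  have hc₃a : IsAlgebraic ℚ c₃ := by
    rw [hc₃]
    exact (((((isAlgebraic_nat 4).mul ha₄).mul (hε₁.pow 3)).add
      (((isAlgebraic_nat 3).mul ha₃).mul (hε₁.pow 2))).add
      (((isAlgebraic_nat 2).mul ha₂).mul hε₁)).add ha₁
  have hσ := r.isSemialgebraic_domain
  have hmem : ∀ p ∈ r.domain, p 0 ∈ Set.Ioo ε₁ ε₂ := fun p hp => by rw [hdom] at hp; exact hp
  have hgt : ∀ p ∈ r.domain, ε₁ < p 0 := fun p hp => (hmem p hp).1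
  have h21 : 0 < ε₂ - ε₁ := sub_pos.2 hlt
  -- the chart `φ x = c₃/(x − ε₁)` and its derivative `φ′ x = −c₃/(x − ε₁)²` are semialgebraic
  have h1 : IsSemialgebraicFunOn ℚ r.domain (fun p => p 0 - ε₁) :=
    (isSemialgebraicFunOn_apply hσ 0).fun_sub (isSemialgebraicFunOn_const_of_isAlgebraic hσ hε₁)
  have hφ : IsSemialgebraicFunOn ℚ r.domain (fun p => c₃ / (p 0 - ε₁)) :=
    ((isSemialgebraicFunOn_const_of_isAlgebraic hσ hc₃a).fun_mul h1.fun_inv).congr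
      fun p _ => by rw [div_eq_mul_inv]
  have hφ' : IsSemialgebraicFunOn ℚ r.domain (fun p => -(c₃ / (p 0 - ε₁) ^ 2)) :=
    ((isSemialgebraicFunOn_const_of_isAlgebraic hσ hc₃a).fun_mul
      (h1.fun_pow 2).fun_inv).fun_neg.congr fun p _ => by rw [div_eq_mul_inv]
  have hderiv : ∀ p ∈ r.domain, HasDerivAt (fun t : ℝ => c₃ / (t - ε₁))
      (-(c₃ / (p 0 - ε₁) ^ 2)) (p 0) := by
    intro p hp
    have hne : p 0 - ε₁ ≠ 0 := (sub_pos.2 (hgt p hp)).ne'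
    refine ((hasDerivAt_const (p 0) c₃).div ((hasDerivAt_id' (p 0)).sub_const ε₁)
      hne).congr_deriv ?_
    ring
  have hne : ∀ p ∈ r.domain, -(c₃ / (p 0 - ε₁) ^ 2) ≠ 0 := fun p hp =>
    neg_ne_zero.2 (div_pos hder (pow_pos (sub_pos.2 (hgt p hp)) 2)).ne'
  have hinj : InjOn (fun p : Fin 1 → ℝ => fun _ : Fin 1 => c₃ / (p 0 - ε₁)) r.domain := by
    intro p hp p' hp' h
    have h0 : c₃ / (p 0 - ε₁) = c₃ / (p' 0 - ε₁) := congrFun h 0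
    have ha : 0 < p 0 - ε₁ := sub_pos.2 (hgt p hp)
    have hb : 0 < p' 0 - ε₁ := sub_pos.2 (hgt p' hp')
    rw [div_eq_div_iff ha.ne' hb.ne'] at h0
    have h3 : p' 0 - ε₁ = p 0 - ε₁ := mul_left_cancel₀ hder.ne' h0
    have : p 0 = p' 0 := by linarith
    rw [KZ.eq_const_apply_zero p, KZ.eq_const_apply_zero p', this]
  obtain ⟨s, hs, hsi, hrel⟩ := helper_cells_1 r (fun t => c₃ / (t - ε₁))
    (fun t => -(c₃ / (t - ε₁) ^ 2)) hφ hφ' hderiv hne hinj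
  refine ⟨s, ?_, ?_, ?_, ?_, hrel⟩
  · -- the image of the oval `(ε₁, ε₂)` is the ray `(c₃/(ε₂ − ε₁), ∞)`
    rw [hs]
    ext z
    constructor
    · rintro ⟨p, hp, rfl⟩
      have ha : 0 < p 0 - ε₁ := sub_pos.2 (hgt p hp)
      have hlt' : p 0 - ε₁ < ε₂ - ε₁ := by linarith [(hmem p hp).2]
      exact div_lt_div_of_pos_left hder ha hlt'
    · intro hz
      have hz' : c₃ / (ε₂ - ε₁) < z 0 := hz
      have hv : 0 < z 0 := (div_pos hder h21).trans hz'
      have hx1 : 0 < c₃ / z 0 := div_pos hder hv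
      have hx2 : c₃ / z 0 < ε₂ - ε₁ := by
        rw [div_lt_iff₀ hv]
        calc c₃ = c₃ / (ε₂ - ε₁) * (ε₂ - ε₁) := (div_mul_cancel₀ c₃ h21.ne').symm
          _ < z 0 * (ε₂ - ε₁) := mul_lt_mul_of_pos_right hz' h21
          _ = (ε₂ - ε₁) * z 0 := mul_comm _ _
      refine ⟨fun _ => ε₁ + c₃ / z 0, ?_, ?_⟩
      · rw [hdom]
        show ε₁ + c₃ / z 0 ∈ Set.Ioo ε₁ ε₂
        exact ⟨by linarith, by linarith⟩
      · rw [KZ.eq_const_apply_zero z]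
        funext i
        show c₃ / (ε₁ + c₃ / z 0 - ε₁) = z 0
        rw [add_sub_cancel_left, div_div_cancel₀ hder.ne']
  · -- the integrand of the push-forward is `c₀/√D`
    intro z hz
    rw [hs] at hz
    obtain ⟨p, hp, rfl⟩ := hz
    have hx : ε₁ < p 0 := hgt p hp
    show s.integrand (fun _ => c₃ / (p 0 - ε₁)) =
      c₀ / Real.sqrt ((c₃ / (p 0 - ε₁)) ^ 3 + c₂ * (c₃ / (p 0 - ε₁)) ^ 2 +
        c₁ * c₃ * (c₃ / (p 0 - ε₁)) + a₄ * c₃ ^ 2)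
    rw [hsi p hp, hint p hp, quarticOvalCell_sqrt hq₁ hc₃ hc₂ hc₁ hder hx, abs_neg,
      abs_of_pos (div_pos hder (pow_pos (sub_pos.2 hx) 2)), div_div, mul_comm]
  · -- `D` vanishes at the end point `φ(ε₂) = c₃/(ε₂ − ε₁)` because `q(ε₂) = 0`
    rw [quarticOvalCell_identity hq₁ hc₃ hc₂ hc₁ hlt.ne', hq₂, mul_zero]
  · -- `D > 0` on the ray because `q > 0` on the oval: `v = φ(ε₁ + c₃/v)`
    intro v hv
    have hv0 : 0 < v := (div_pos hder h21).trans hv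
    have hx1 : 0 < c₃ / v := div_pos hder hv0
    have hx2 : c₃ / v < ε₂ - ε₁ := by
      rw [div_lt_iff₀ hv0]
      calc c₃ = c₃ / (ε₂ - ε₁) * (ε₂ - ε₁) := (div_mul_cancel₀ c₃ h21.ne').symm
        _ < v * (ε₂ - ε₁) := mul_lt_mul_of_pos_right hv h21
        _ = (ε₂ - ε₁) * v := mul_comm _ _
    have hne' : ε₁ + c₃ / v ≠ ε₁ := by linarith
    have key := quarticOvalCell_identity (x := ε₁ + c₃ / v) hq₁ hc₃ hc₂ hc₁ hne'
    rw [add_sub_cancel_left, div_div_cancel₀ hder.ne'] at key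
    rw [key]
    exact mul_pos (pow_pos (div_pos hder (pow_pos hx1 2)) 2) (hpos _ ⟨by linarith, by linarith⟩)

/-- STUB `stub_quarticOvalCell` — **a complete first-kind quartic oval integral is ONE Möbius move
away from a complete branch integral of the resolvent cubic.**  For
`q(x) = a₄x⁴ + a₃x³ + a₂x² + a₁x + a₀` over `ℚ̄ ∩ ℝ`, consecutive real roots `ε₁ < ε₂` with `q > 0`
on `(ε₁, ε₂)` and `c₃ = q′(ε₁) > 0`, the change of variables `v = c₃/(x − ε₁)` (rule 2 in dimension
one: semialgebraic, injective, `C¹` on the cell) maps `(ε₁, ε₂)` onto `(c₃/(ε₂ − ε₁), ∞)` and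
`c₀ dx/√q(x)` to `c₀ dv/√D(v)` with the MONIC cubic `D(v) = v³ + c₂v² + c₁c₃v + a₄c₃²`,
`c₂ = q″(ε₁)/2`, `c₁ = q‴(ε₁)/6` (Taylor expansion of `q` at `ε₁`: `v⁴ q(ε₁ + c₃/v) = c₃² D(v)`);
`D` vanishes at the new end point and is positive beyond it.
[cite: KontsevichZagier2001, §1.2 (rule 2)] [cite: HuberWustholz2022, §13.2] -/
theorem stub_quarticOvalCell (a₄ a₃ a₂ a₁ a₀ : ℝ) (ha₄ : IsAlgebraic ℚ a₄) (ha₃ : IsAlgebraic ℚ a₃)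
    (ha₂ : IsAlgebraic ℚ a₂) (ha₁ : IsAlgebraic ℚ a₁) (ha₀ : IsAlgebraic ℚ a₀)
    (ε₁ ε₂ c₀ : ℝ) (hε₁ : IsAlgebraic ℚ ε₁) (hε₂ : IsAlgebraic ℚ ε₂) (hc₀ : IsAlgebraic ℚ c₀)
    (hlt : ε₁ < ε₂)
    (hq₁ : a₄ * ε₁ ^ 4 + a₃ * ε₁ ^ 3 + a₂ * ε₁ ^ 2 + a₁ * ε₁ + a₀ = 0)
    (hq₂ : a₄ * ε₂ ^ 4 + a₃ * ε₂ ^ 3 + a₂ * ε₂ ^ 2 + a₁ * ε₂ + a₀ = 0)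
    (hpos : ∀ x ∈ Set.Ioo ε₁ ε₂, 0 < a₄ * x ^ 4 + a₃ * x ^ 3 + a₂ * x ^ 2 + a₁ * x + a₀)
    (hder : 0 < 4 * a₄ * ε₁ ^ 3 + 3 * a₃ * ε₁ ^ 2 + 2 * a₂ * ε₁ + a₁)
    (r : KZ.IntegralRep 1) (hdom : r.domain = {z | z 0 ∈ Set.Ioo ε₁ ε₂})
    (hint : ∀ z ∈ r.domain, r.integrand z =
      c₀ / Real.sqrt (a₄ * (z 0) ^ 4 + a₃ * (z 0) ^ 3 + a₂ * (z 0) ^ 2 + a₁ * (z 0) + a₀)) :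
    ∃ r' : KZ.IntegralRep 1,
      r'.domain = {z | (4 * a₄ * ε₁ ^ 3 + 3 * a₃ * ε₁ ^ 2 + 2 * a₂ * ε₁ + a₁) / (ε₂ - ε₁) < z 0} ∧
      (∀ z ∈ r'.domain, r'.integrand z = c₀ / Real.sqrt ((z 0) ^ 3 +
        (6 * a₄ * ε₁ ^ 2 + 3 * a₃ * ε₁ + a₂) * (z 0) ^ 2 +
        (4 * a₄ * ε₁ + a₃) * (4 * a₄ * ε₁ ^ 3 + 3 * a₃ * ε₁ ^ 2 + 2 * a₂ * ε₁ + a₁) * (z 0) +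
        a₄ * (4 * a₄ * ε₁ ^ 3 + 3 * a₃ * ε₁ ^ 2 + 2 * a₂ * ε₁ + a₁) ^ 2)) ∧
      ((4 * a₄ * ε₁ ^ 3 + 3 * a₃ * ε₁ ^ 2 + 2 * a₂ * ε₁ + a₁) / (ε₂ - ε₁)) ^ 3 +
          (6 * a₄ * ε₁ ^ 2 + 3 * a₃ * ε₁ + a₂) *
            ((4 * a₄ * ε₁ ^ 3 + 3 * a₃ * ε₁ ^ 2 + 2 * a₂ * ε₁ + a₁) / (ε₂ - ε₁)) ^ 2 +
          (4 * a₄ * ε₁ + a₃) * (4 * a₄ * ε₁ ^ 3 + 3 * a₃ * ε₁ ^ 2 + 2 * a₂ * ε₁ + a₁) *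
            ((4 * a₄ * ε₁ ^ 3 + 3 * a₃ * ε₁ ^ 2 + 2 * a₂ * ε₁ + a₁) / (ε₂ - ε₁)) +
          a₄ * (4 * a₄ * ε₁ ^ 3 + 3 * a₃ * ε₁ ^ 2 + 2 * a₂ * ε₁ + a₁) ^ 2 = 0 ∧
      (∀ v : ℝ, (4 * a₄ * ε₁ ^ 3 + 3 * a₃ * ε₁ ^ 2 + 2 * a₂ * ε₁ + a₁) / (ε₂ - ε₁) < v →
        0 < v ^ 3 + (6 * a₄ * ε₁ ^ 2 + 3 * a₃ * ε₁ + a₂) * v ^ 2 +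
          (4 * a₄ * ε₁ + a₃) * (4 * a₄ * ε₁ ^ 3 + 3 * a₃ * ε₁ ^ 2 + 2 * a₂ * ε₁ + a₁) * v +
          a₄ * (4 * a₄ * ε₁ ^ 3 + 3 * a₃ * ε₁ ^ 2 + 2 * a₂ * ε₁ + a₁) ^ 2) ∧
      KZ.of r - KZ.of r' ∈ M₁ :=
  quarticOvalCell_of_eq a₄ a₃ a₂ a₁ a₀ ha₄ ha₃ ha₂ ha₁ ha₀ ε₁ ε₂ c₀ hε₁ hε₂ hc₀ _ _ _ rfl rfl rfl
    hlt hq₁ hq₂ hpos hder r hdom hint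

end QuarticLayer

end Summit.KontsevichZagierPeriods.SymplecticScissors.RealOnePeriodRelations

end
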